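import Summits.RiemannHypothesis.RiemannHypothesis.Theses.WeilComb
import Summits.RiemannHypothesis.RiemannHypothesis.Theorems.WeilCombCombHelsonBound
import Literature.NumberTheory.LFunctions.RosserSchoenfeldVonMangoldtSum
import Literature.NumberTheory.LFunctions.RosserSchoenfeldMertensFirstProofs
import Literature.NumberTheory.LFunctions.RosserSchoenfeldMertensFirstConstant
import Mathlib.Analysis.Complex.ExponentialBounds

/-!
# Stub `stub_helsonG` of line `Sketch` for crux `WeilComb.CombShapePositivity`
(item stmt-RiemannHypothesis-11229, route route-RiemannHypothesis-WeilComb)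

The Helson potential with the sharpened prime-power constant: for every `M` and `a : ℕ → ℂ`,

`Σ_{m ≤ M} ‖a_m‖² (log m + ψ₁(M/m)) ≤ (log M + 39/50) Σ_{m ≤ M} ‖a_m‖²`,
`ψ₁(y) = Σ_{n ≤ y} Λ(n)/n`.

Proof. Termwise for `1 ≤ m ≤ M` (then multiply by `‖a_m‖² ≥ 0` and sum): with `y = M/m ≥ 1`,
`ψ₁(y) = Σ_{p ≤ y} (log p)/p + Σ_{n ≤ y, n not prime} Λ(n)/n`; the first sum is `≤ log y`
(Rosser–Schoenfeld (3.24), `RosserSchoenfeld1962_eq_3_24_holds`), the second is at most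
`Σ_{n not prime} Λ(n)/n = Σ_p (log p)/(p(p−1))`
(`RosserSchoenfeld.tsum_vonMangoldt_nonPrime_div`), and `log m + log(M/m) = log M`. The constant is
the numerical bound

`Σ_p (log p)/(p(p−1)) ≤ 0.7724 < 39/50`

(true value `0.75536…`, Rosser–Schoenfeld (2.11)), sharpening the tree's
`RosserSchoenfeld.tsum_primes_log_div_mul_pred_lt_one` (`< 1`): the 24 primes `p ≤ 89` are taken
explicitly, each `log p` certified in units of `log 2 < 0.6931471808` from `p^d ≤ 2^c`
(`RosserSchoenfeld324.pow_log_le`; `3^41 ≤ 2^65`, `5^31 ≤ 2^72`, `7^26 ≤ 2^73`, `11^13 ≤ 2^45`,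
`13^7 ≤ 2^26`, `17^4, 19^4 ≤ 2^17`, and `p < 2^5, 2^6, 2^7` for the rest), giving a head
`≤ 0.74802`;
the tail over the primes `p ≥ 97` uses that a prime `≥ 5` is `≡ ±1 (mod 6)` and that
`g(n) = log n/(n(n−1))` is non-increasing for `n ≥ 2`: in the block `{6k, …, 6k+5}` (`k ≥ 16`) only
`6k+1, 6k+5` can be prime, and
`g(6k+1) + g(6k+5) ≤ (1/3) Σ_{n=6k−1}^{6k+4} g(n) ≤ (1/3)(F(6k−2) − F(6k+4))`
with the telescoping majorant `g(n) ≤ F(n−1) − F(n)`, `F(t) = (log t + 2)/t`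
(`RosserSchoenfeld.log_div_mul_pred_le_sub`); hence the tail is
`≤ F(94)/3 = (log 94 + 2)/282 ≤ 0.0243`.
-/

noncomputable section

-- the sub-problem path RiemannHypothesis/RiemannHypothesis duplicates a namespace (D-0017)
set_option linter.dupNamespace false

open scoped BigOperators ComplexConjugate
open Complex MeasureTheory

namespace Summit.RiemannHypothesis.RiemannHypothesis.Theorems.WeilCombBohrFejer

open Literature.NumberTheory.LFunctions

/-- `g(n) = log n/(n(n−1)) ≥ 0` for every natural `n` (`g(0) = g(1) = 0`). [folklore] -/
private theorem g_nonneg_helsonG {g : ℕ → ℝ}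
    (hg : ∀ n : ℕ, g n = Real.log (n : ℝ) / ((n : ℝ) * ((n : ℝ) - 1))) (n : ℕ) : 0 ≤ g n := by
  rw [hg]
  rcases Nat.eq_zero_or_pos n with rfl | hn
  · simp
  · have h1 : (1 : ℝ) ≤ n := by exact_mod_cast hn
    exact div_nonneg (Real.log_nonneg h1) (mul_nonneg (by linarith) (by linarith))

/-- `g(n) = log n/(n(n−1))` is non-increasing from `n = 2` on: `g(n+1) ≤ g(n)` for `n ≥ 2`
(`(n−1) log(n+1) ≤ (n−1)(log n + 1/n) ≤ (n+1) log n` as `log n ≥ log 2 > 1/2`). [folklore] -/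
private theorem log_div_mul_pred_anti_helsonG {n : ℕ} (hn : 2 ≤ n) :
    Real.log ((n + 1 : ℕ) : ℝ) / (((n + 1 : ℕ) : ℝ) * (((n + 1 : ℕ) : ℝ) - 1)) ≤
      Real.log n / ((n : ℝ) * ((n : ℝ) - 1)) := by
  have hc : ((n + 1 : ℕ) : ℝ) = (n : ℝ) + 1 := by push_cast; ring
  rw [hc, add_sub_cancel_right]
  have hn' : (2 : ℝ) ≤ n := by exact_mod_cast hn
  have h0 : (0 : ℝ) < n := by linarith
  have h1 : (0 : ℝ) < n - 1 := by linarith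
  have hlog : (1 / 2 : ℝ) < Real.log n := by
    have h2 := Real.log_two_gt_d9
    have h3 := Real.log_le_log (by norm_num) hn'
    linarith
  have hsucc : Real.log ((n : ℝ) + 1) ≤ Real.log n + 1 / n := by
    have h := Real.log_le_sub_one_of_pos (show (0 : ℝ) < ((n : ℝ) + 1) / n by positivity)
    rw [Real.log_div (by linarith) h0.ne'] at h
    have he : ((n : ℝ) + 1) / n - 1 = 1 / n := by
      field_simp
      ring
    linarith
  rw [div_le_div_iff₀ (by positivity) (by positivity)]
  have k1 : Real.log ((n : ℝ) + 1) * (n - 1) ≤ (Real.log n + 1 / n) * (n - 1) :=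
    mul_le_mul_of_nonneg_right hsucc h1.le
  have k2 : (Real.log n + 1 / n) * (n - 1) ≤ Real.log n * (n + 1) := by
    have h2 : ((n : ℝ) - 1) / n ≤ 1 := by
      rw [div_le_one h0]
      linarith
    have h3 : (Real.log n + 1 / n) * (n - 1) = Real.log n * (n - 1) + (n - 1) / n := by ring
    rw [h3]
    nlinarith
  calc Real.log ((n : ℝ) + 1) * (n * (n - 1))
      = (Real.log ((n : ℝ) + 1) * (n - 1)) * n := by ring
    _ ≤ (Real.log n * (n + 1)) * n := mul_le_mul_of_nonneg_right (k1.trans k2) h0.le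
    _ = Real.log n * ((n + 1) * n) := by ring

/-- One block of six consecutive integers `6j+6, …, 6j+11` (`j ≥ 0`): only `6j+7` and `6j+11` can be
prime, and `g(6j+7) + g(6j+11) ≤ (1/3) Σ_{n=6j+5}^{6j+10} g(n) ≤ (1/3)(F(6j+4) − F(6j+10))`,
`F(t) = (log t + 2)/t`, by monotonicity of `g` and the telescoping majorant `g(n) ≤ F(n−1) − F(n)`.
[folklore] -/
private theorem block_helsonG {g T : ℕ → ℝ}
    (hg : ∀ n : ℕ, g n = Real.log (n : ℝ) / ((n : ℝ) * ((n : ℝ) - 1)))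
    (hT : ∀ n : ℕ, T n = if n.Prime then g n else 0) (j : ℕ) :
    ∑ r ∈ Finset.range 6, T (6 * j + 6 + r) ≤
      ((Real.log ((6 * j + 4 : ℕ) : ℝ) + 2) / ((6 * j + 4 : ℕ) : ℝ) -
        (Real.log ((6 * j + 10 : ℕ) : ℝ) + 2) / ((6 * j + 10 : ℕ) : ℝ)) / 3 := by
  obtain ⟨F, hF⟩ : ∃ F : ℕ → ℝ, ∀ k : ℕ, F k = (Real.log k + 2) / k :=
    ⟨fun k ↦ (Real.log k + 2) / k, fun k ↦ rfl⟩
  have hg0 : ∀ n : ℕ, 0 ≤ g n := g_nonneg_helsonG hg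
  -- telescoping steps `g (n+1) ≤ F n - F (n+1)`
  have hstep : ∀ n m : ℕ, 1 ≤ n → m = n + 1 → g m ≤ F n - F m := by
    rintro n m hn rfl
    rw [hg, hF, hF]
    have h := RosserSchoenfeld.log_div_mul_pred_le_sub (n := n + 1) (by omega)
    have hc : ((n + 1 : ℕ) : ℝ) - 1 = (n : ℝ) := by push_cast; ring
    rw [hc] at h
    rw [hc]
    exact h
  -- monotone steps `g (n+1) ≤ g n`
  have hmono : ∀ n m : ℕ, 2 ≤ n → m = n + 1 → g m ≤ g n := by
    rintro n m hn rfl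
    rw [hg, hg]
    exact log_div_mul_pred_anti_helsonG hn
  -- the four composites of the block
  have hc0 : ¬ (6 * j + 6).Prime := by
    rw [show 6 * j + 6 = 2 * (3 * j + 3) by ring, Nat.prime_mul_iff]
    rintro (⟨-, h⟩ | ⟨-, h⟩) <;> omega
  have hc2 : ¬ (6 * j + 8).Prime := by
    rw [show 6 * j + 8 = 2 * (3 * j + 4) by ring, Nat.prime_mul_iff]
    rintro (⟨-, h⟩ | ⟨-, h⟩) <;> omega
  have hc3 : ¬ (6 * j + 9).Prime := by
    rw [show 6 * j + 9 = 3 * (2 * j + 3) by ring, Nat.prime_mul_iff]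
    rintro (⟨-, h⟩ | ⟨-, h⟩) <;> omega
  have hc4 : ¬ (6 * j + 10).Prime := by
    rw [show 6 * j + 10 = 2 * (3 * j + 5) by ring, Nat.prime_mul_iff]
    rintro (⟨-, h⟩ | ⟨-, h⟩) <;> omega
  have e1 : 6 * j + 6 + 1 = 6 * j + 7 := rfl
  have e2 : 6 * j + 6 + 2 = 6 * j + 8 := rfl
  have e3 : 6 * j + 6 + 3 = 6 * j + 9 := rfl
  have e4 : 6 * j + 6 + 4 = 6 * j + 10 := rfl
  have e5 : 6 * j + 6 + 5 = 6 * j + 11 := rfl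
  simp only [Finset.sum_range_succ, Finset.sum_range_zero, zero_add, add_zero, e1, e2, e3, e4, e5,
    hT, if_neg hc0, if_neg hc2, if_neg hc3, if_neg hc4]
  -- the two possible primes
  have i7 : (if (6 * j + 7).Prime then g (6 * j + 7) else 0) ≤ g (6 * j + 7) := by
    split_ifs
    · exact le_rfl
    · exact hg0 _
  have i11 : (if (6 * j + 11).Prime then g (6 * j + 11) else 0) ≤ g (6 * j + 11) := by
    split_ifs
    · exact le_rfl
    · exact hg0 _
  have m7 : g (6 * j + 7) ≤ g (6 * j + 6) := hmono (6 * j + 6) (6 * j + 7) (by omega) (by omega)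
  have m6 : g (6 * j + 6) ≤ g (6 * j + 5) := hmono (6 * j + 5) (6 * j + 6) (by omega) (by omega)
  have m11 : g (6 * j + 11) ≤ g (6 * j + 10) :=
    hmono (6 * j + 10) (6 * j + 11) (by omega) (by omega)
  have m10 : g (6 * j + 10) ≤ g (6 * j + 9) := hmono (6 * j + 9) (6 * j + 10) (by omega) (by omega)
  have m9 : g (6 * j + 9) ≤ g (6 * j + 8) := hmono (6 * j + 8) (6 * j + 9) (by omega) (by omega)
  have s5 : g (6 * j + 5) ≤ F (6 * j + 4) - F (6 * j + 5) :=
    hstep (6 * j + 4) (6 * j + 5) (by omega) (by omega)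
  have s6 : g (6 * j + 6) ≤ F (6 * j + 5) - F (6 * j + 6) :=
    hstep (6 * j + 5) (6 * j + 6) (by omega) (by omega)
  have s7 : g (6 * j + 7) ≤ F (6 * j + 6) - F (6 * j + 7) :=
    hstep (6 * j + 6) (6 * j + 7) (by omega) (by omega)
  have s8 : g (6 * j + 8) ≤ F (6 * j + 7) - F (6 * j + 8) :=
    hstep (6 * j + 7) (6 * j + 8) (by omega) (by omega)
  have s9 : g (6 * j + 9) ≤ F (6 * j + 8) - F (6 * j + 9) :=
    hstep (6 * j + 8) (6 * j + 9) (by omega) (by omega)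
  have s10 : g (6 * j + 10) ≤ F (6 * j + 9) - F (6 * j + 10) :=
    hstep (6 * j + 9) (6 * j + 10) (by omega) (by omega)
  rw [← hF (6 * j + 4), ← hF (6 * j + 10)]
  linarith

/-- The prime tail, telescoped block by block: for every `m`,
`Σ_{i<m, i+96 prime} g(i+96) ≤ F(94)/3 = (log 94 + 2)/282`. [folklore] -/
private theorem tail_helsonG {g T : ℕ → ℝ}
    (hg : ∀ n : ℕ, g n = Real.log (n : ℝ) / ((n : ℝ) * ((n : ℝ) - 1)))
    (hT : ∀ n : ℕ, T n = if n.Prime then g n else 0) (m : ℕ) :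
    ∑ i ∈ Finset.range m, T (i + 96) ≤ (Real.log 94 + 2) / 282 := by
  obtain ⟨F, hF⟩ : ∃ F : ℕ → ℝ, ∀ k : ℕ, F k = (Real.log k + 2) / k :=
    ⟨fun k ↦ (Real.log k + 2) / k, fun k ↦ rfl⟩
  have hT0 : ∀ n, 0 ≤ T n := fun n ↦ by
    rw [hT]
    split_ifs
    · exact g_nonneg_helsonG hg n
    · exact le_rfl
  have hFnn : ∀ k : ℕ, 0 ≤ F k := fun k ↦ by
    rw [hF]
    exact div_nonneg (by linarith [Real.log_natCast_nonneg k]) (Nat.cast_nonneg k)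
  have hblock : ∀ l : ℕ, ∑ r ∈ Finset.range 6, T (6 * l + 96 + r) ≤
      (F (6 * l + 94) - F (6 * l + 100)) / 3 := by
    intro l
    have h := block_helsonG hg hT (l + 15)
    rw [show 6 * (l + 15) + 6 = 6 * l + 96 by ring, show 6 * (l + 15) + 4 = 6 * l + 94 by ring,
      show 6 * (l + 15) + 10 = 6 * l + 100 by ring, ← hF, ← hF] at h
    exact h
  have hind : ∀ l : ℕ, ∑ i ∈ Finset.range (6 * l), T (i + 96) ≤ (F 94 - F (6 * l + 94)) / 3 := by
    intro l
    induction l with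
    | zero => simp
    | succ l ih =>
      rw [show 6 * (l + 1) = 6 * l + 6 by ring, Finset.sum_range_add,
        show 6 * l + 6 + 94 = 6 * l + 100 by ring]
      have hb := hblock l
      have hs : ∑ x ∈ Finset.range 6, T (6 * l + x + 96) =
          ∑ r ∈ Finset.range 6, T (6 * l + 96 + r) :=
        Finset.sum_congr rfl fun x _ ↦ by rw [add_right_comm]
      rw [hs]
      linarith
  have hm : m ≤ 6 * (m / 6 + 1) := by omega
  calc ∑ i ∈ Finset.range m, T (i + 96)
      ≤ ∑ i ∈ Finset.range (6 * (m / 6 + 1)), T (i + 96) :=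
        Finset.sum_le_sum_of_subset_of_nonneg (Finset.range_subset_range.2 hm) fun i _ _ ↦ hT0 _
    _ ≤ (F 94 - F (6 * (m / 6 + 1) + 94)) / 3 := hind _
    _ ≤ F 94 / 3 := by linarith [hFnn (6 * (m / 6 + 1) + 94)]
    _ = (Real.log 94 + 2) / 282 := by
        rw [hF, div_div]
        norm_num

/-- The prime head `p ≤ 89`: `Σ_{p < 96} (log p)/(p(p−1)) ≤ 0.74802`, each `log p` certified in
units of `log 2 < 0.6931471808` from `p^d ≤ 2^c`. [folklore] -/
private theorem head_helsonG {g T : ℕ → ℝ}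
    (hg : ∀ n : ℕ, g n = Real.log (n : ℝ) / ((n : ℝ) * ((n : ℝ) - 1)))
    (hT : ∀ n : ℕ, T n = if n.Prime then g n else 0) :
    ∑ i ∈ Finset.range 96, T i ≤ 0.74802 := by
  have hl2 : Real.log 2 < 0.6931471808 := Real.log_two_lt_d9
  have h3 := RosserSchoenfeld324.pow_log_le 3 41 2 65
  have h5 := RosserSchoenfeld324.pow_log_le 5 31 2 72
  have h7 := RosserSchoenfeld324.pow_log_le 7 26 2 73
  have h11 := RosserSchoenfeld324.pow_log_le 11 13 2 45
  have h13 := RosserSchoenfeld324.pow_log_le 13 7 2 26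
  have h17 := RosserSchoenfeld324.pow_log_le 17 4 2 17
  have h19 := RosserSchoenfeld324.pow_log_le 19 4 2 17
  have h23 := RosserSchoenfeld324.pow_log_le 23 1 2 5
  have h29 := RosserSchoenfeld324.pow_log_le 29 1 2 5
  have h31 := RosserSchoenfeld324.pow_log_le 31 1 2 5
  have h37 := RosserSchoenfeld324.pow_log_le 37 1 2 6
  have h41 := RosserSchoenfeld324.pow_log_le 41 1 2 6
  have h43 := RosserSchoenfeld324.pow_log_le 43 1 2 6
  have h47 := RosserSchoenfeld324.pow_log_le 47 1 2 6
  have h53 := RosserSchoenfeld324.pow_log_le 53 1 2 6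
  have h59 := RosserSchoenfeld324.pow_log_le 59 1 2 6
  have h61 := RosserSchoenfeld324.pow_log_le 61 1 2 6
  have h67 := RosserSchoenfeld324.pow_log_le 67 1 2 7
  have h71 := RosserSchoenfeld324.pow_log_le 71 1 2 7
  have h73 := RosserSchoenfeld324.pow_log_le 73 1 2 7
  have h79 := RosserSchoenfeld324.pow_log_le 79 1 2 7
  have h83 := RosserSchoenfeld324.pow_log_le 83 1 2 7
  have h89 := RosserSchoenfeld324.pow_log_le 89 1 2 7
  push_cast at h3 h5 h7 h11 h13 h17 h19 h23 h29 h31 h37 h41 h43 h47 h53 h59 h61 h67 h71 h73 h79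
  push_cast at h83 h89
  simp only [Finset.sum_range_succ, Finset.sum_range_zero, hT, hg]
  norm_num
  linarith

/-- **`Σ_p (log p)/(p(p−1)) ≤ 0.7724`** (true value `0.75536…`): the head `p ≤ 89` (`≤ 0.74802`)
plus the tail `p ≥ 97` (`≤ (log 94 + 2)/282 ≤ 0.0243`, primes `≡ ±1 (mod 6)` and telescoping).
[cite: RosserSchoenfeld1962, (2.8) with (2.11)] -/
private theorem tsum_primes_log_div_mul_pred_le_helsonG :
    ∑' p : Nat.Primes, Real.log (p : ℝ) / ((p : ℝ) * ((p : ℝ) - 1)) ≤ 0.7724 := by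
  set g : ℕ → ℝ := fun n ↦ Real.log (n : ℝ) / ((n : ℝ) * ((n : ℝ) - 1)) with hg
  have hg' : ∀ n : ℕ, g n = Real.log (n : ℝ) / ((n : ℝ) * ((n : ℝ) - 1)) := fun n ↦ rfl
  have hsub : ∑' p : Nat.Primes, g p = ∑' n : ℕ, (setOf Nat.Prime).indicator g n :=
    tsum_subtype (setOf Nat.Prime) g
  have hsumP : Summable (g ∘ ((↑) : (setOf Nat.Prime) → ℕ)) :=
    RosserSchoenfeld.summable_primes_log_div_mul_pred
  have hsum : Summable ((setOf Nat.Prime).indicator g) := summable_subtype_iff_indicator.mp hsumP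
  have hind : ∀ n, (setOf Nat.Prime).indicator g n = if n.Prime then g n else 0 := fun n ↦ by
    simp only [Set.indicator_apply, Set.mem_setOf_eq]
  have hT0 : ∀ n, 0 ≤ (setOf Nat.Prime).indicator g n := fun n ↦ by
    rw [hind]
    split_ifs
    · exact g_nonneg_helsonG hg' n
    · exact le_rfl
  change ∑' p : Nat.Primes, g p ≤ _
  rw [hsub, ← Summable.sum_add_tsum_nat_add 96 hsum]
  have hhead := head_helsonG hg' hind
  have htail : ∑' i : ℕ, (setOf Nat.Prime).indicator g (i + 96) ≤ (Real.log 94 + 2) / 282 :=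
    Real.tsum_le_of_sum_range_le (fun i ↦ hT0 _) (fun m ↦ tail_helsonG hg' hind m)
  have h94 := RosserSchoenfeld324.pow_log_le 94 1 2 7
  push_cast at h94
  have hl2 : Real.log 2 < 0.6931471808 := Real.log_two_lt_d9
  have htail' : (Real.log 94 + 2) / 282 ≤ 0.0243 := by
    rw [div_le_iff₀ (by norm_num)]
    linarith
  linarith

/-- **`Σ_{n ≤ x} Λ(n)/n ≤ log x + 0.7724` for real `x ≥ 1`**: `Σ_{n≤x} Λ(n)/n = Σ_{p≤x} (log p)/p +
Σ_{pᵏ ≤ x, k ≥ 2} (log p)/pᵏ`, the first sum is `≤ log x` by Rosser–Schoenfeld's (3.24)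
(`RosserSchoenfeld1962_eq_3_24_holds`), the second is at most `Σ_p (log p)/(p(p−1)) ≤ 0.7724`.
[cite: RosserSchoenfeld1962, (3.24) with (2.8), (2.11)] -/
private theorem sum_vonMangoldt_div_le_helsonG {x : ℝ} (hx : 1 ≤ x) :
    ∑ n ∈ Finset.Ioc 0 ⌊x⌋₊, (ArithmeticFunction.vonMangoldt n : ℝ) / n ≤ Real.log x + 0.7724 := by
  set N := ⌊x⌋₊ with hN
  have hsplit : ∑ n ∈ Finset.Ioc 0 N, (ArithmeticFunction.vonMangoldt n : ℝ) / n =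
      (∑ p ∈ Nat.primesLE N, Real.log p / p) +
        ∑ n ∈ Finset.Ioc 0 N,
          (if n.Prime then 0 else (ArithmeticFunction.vonMangoldt n : ℝ)) / n := by
    have h1 : ∀ n : ℕ, (ArithmeticFunction.vonMangoldt n : ℝ) / n =
        (if n.Prime then Real.log n / n else 0) +
          (if n.Prime then 0 else (ArithmeticFunction.vonMangoldt n : ℝ)) / n := by
      intro n
      split_ifs with hp
      · rw [ArithmeticFunction.vonMangoldt_apply_prime hp]; ring
      · ring
    rw [Finset.sum_congr rfl fun n _ ↦ h1 n, Finset.sum_add_distrib, ← Finset.sum_filter,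
      Nat.primesLE_eq_filter_Ioc_zero]
  have hD : ∑ n ∈ Finset.Ioc 0 N,
      (if n.Prime then 0 else (ArithmeticFunction.vonMangoldt n : ℝ)) / n ≤ 0.7724 := by
    calc _ ≤ ∑' n : ℕ, (if n.Prime then 0 else (ArithmeticFunction.vonMangoldt n : ℝ)) / n :=
          RosserSchoenfeld.summable_vonMangoldt_nonPrime_div.sum_le_tsum _ fun k _ ↦ by
            refine div_nonneg ?_ (Nat.cast_nonneg k)
            split_ifs
            · exact le_rfl
            · exact ArithmeticFunction.vonMangoldt_nonneg
      _ = _ := RosserSchoenfeld.tsum_vonMangoldt_nonPrime_div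
      _ ≤ 0.7724 := tsum_primes_log_div_mul_pred_le_helsonG
  have hP : ∑ p ∈ Nat.primesLE N, Real.log p / p ≤ Real.log x := by
    rcases eq_or_lt_of_le hx with h | h
    · have hN1 : N = 1 := by rw [hN, ← h]; simp
      rw [hN1, show Nat.primesLE 1 = ∅ by decide, Finset.sum_empty]
      exact Real.log_nonneg hx
    · exact (RosserSchoenfeld1962_eq_3_24_holds x h).le
  rw [hsplit]
  linarith

/-- The row sums of the Helson potential: for `1 ≤ m ≤ M`,
`log m + Σ_{n ≤ M/m} Λ(n)/n ≤ log M + 39/50` (`log m + log(M/m) = log M`, `0.7724 ≤ 39/50`).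
[folklore] -/
private theorem log_add_sum_vonMangoldt_div_le_helsonG {M m : ℕ} (hm : m ∈ Finset.Icc 1 M) :
    Real.log m + ∑ n ∈ Finset.Icc 1 (M / m), (ArithmeticFunction.vonMangoldt n : ℝ) / n ≤
      Real.log M + 39 / 50 := by
  have hm1 : 1 ≤ m := (Finset.mem_Icc.1 hm).1
  have hmM : m ≤ M := (Finset.mem_Icc.1 hm).2
  have hm0 : (0 : ℝ) < m := by exact_mod_cast hm1
  have hM0 : (0 : ℝ) < M := by exact_mod_cast (lt_of_lt_of_le hm1 hmM)
  have hmM' : (m : ℝ) ≤ M := by exact_mod_cast hmM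
  have hx : (1 : ℝ) ≤ (M : ℝ) / m := by rwa [le_div_iff₀ hm0, one_mul]
  have key := sum_vonMangoldt_div_le_helsonG hx
  rw [Nat.floor_div_eq_div, Real.log_div hM0.ne' hm0.ne'] at key
  have hI : Finset.Ioc 0 (M / m) = Finset.Icc 1 (M / m) := by
    ext x
    simp only [Finset.mem_Ioc, Finset.mem_Icc]
    omega
  rw [hI] at key
  norm_num at key ⊢
  linarith

/-- **Stub S4 — Helson potential with the sharpened prime-power constant.** For every `M`, `a`:
`Σ_m ‖a_m‖² (log m + ψ₁(M/m)) ≤ (log M + 39/50) Σ ‖a_m‖²`, `ψ₁(y) = Σ_{n ≤ y} Λ(n)/n`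
(termwise `log m + ψ₁(M/m) ≤ log M + 39/50` by Rosser–Schoenfeld (3.24) and
`Σ_p (log p)/(p(p−1)) ≤ 0.7724`). [cite: RosserSchoenfeld1962, (3.24) with (2.8), (2.11)] -/
theorem stub_helsonG : ∀ (M : ℕ) (a : ℕ → ℂ),
    ∑ m ∈ Finset.Icc 1 M, ‖a m‖ ^ 2 *
        (Real.log m + ∑ n ∈ Finset.Icc 1 (M / m), (ArithmeticFunction.vonMangoldt n : ℝ) / n) ≤
      (Real.log M + 39 / 50) * ∑ m ∈ Finset.Icc 1 M, ‖a m‖ ^ 2 := by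
  intro M a
  rw [Finset.mul_sum]
  refine Finset.sum_le_sum fun m hm ↦ ?_
  have h := log_add_sum_vonMangoldt_div_le_helsonG hm
  have h0 : 0 ≤ ‖a m‖ ^ 2 := by positivity
  calc ‖a m‖ ^ 2 *
        (Real.log m + ∑ n ∈ Finset.Icc 1 (M / m), (ArithmeticFunction.vonMangoldt n : ℝ) / n)
      ≤ ‖a m‖ ^ 2 * (Real.log M + 39 / 50) := mul_le_mul_of_nonneg_left h h0
    _ = (Real.log M + 39 / 50) * ‖a m‖ ^ 2 := mul_comm _ _

end Summit.RiemannHypothesis.RiemannHypothesis.Theorems.WeilCombBohrFejer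

end
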